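import Mathlib.CategoryTheory.Galois.Decomposition
import Mathlib.CategoryTheory.Subobject.Basic
import Mathlib.CategoryTheory.Limits.MonoCoprod
import Mathlib.CategoryTheory.Limits.Types.Coproducts
import Mathlib.CategoryTheory.Limits.Types.Products
import Mathlib.CategoryTheory.Limits.Preserves.Shapes.Terminal
import Mathlib.CategoryTheory.Limits.Preserves.Shapes.BinaryProducts
import HarnessLib

/-!
# Connected components of a finite sum of terminal objects in a Galois category

Mathlib-level lemmas for the anabelioid dictionary (`Literature.AnabelianGeometry.Anabelioids`),
[SGA1, Exp. V §4–5]: in a Galois category `C` (a connected anabelioid),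

* `isConnected_of_iso`, `isConnected_terminal`: connectedness is invariant under isomorphism and
  the terminal object `1` is connected (its fibre is a point);
* for a finite family of copies of `1`, the summands `1 ↪ ∐_{j ∈ J} 1` are connected subobjects
  (`isConnected_subobjectMk_sigma_ι`), pairwise distinct (`subobjectMk_sigma_ι_injective`), and
  every connected subobject is one of them (`exists_eq_subobjectMk_sigma_ι`) — i.e. the connected
  components of the trivial covering `∐_J 1` ARE the sheets `J`.

These are the facts behind "a graph-covering `𝔾' → 𝔾` of the underlying semi-graph gives a finite
étale covering of `𝒢`" ([SemiAnbd] p. 23): the vertices of `𝔾'` over `v` are the connected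
components of `∐_{ψ⁻¹ v} 1`.  Proofs go through a fibre functor `F` (fibres of `1`, of binary and
finite coproducts; Mathlib's `connected_component_unique`).  No definitions.
-/

namespace Literature.AnabelianGeometry.Anabelioids

open CategoryTheory CategoryTheory.Limits CategoryTheory.PreGaloisCategory

universe w u₂ u₁

variable {C : Type u₁} [Category.{u₂} C]

/-- Connectedness of objects is invariant under isomorphism. [cite: SGA1, Exp. V §4 (condition (G3))] -/
theorem isConnected_of_iso {X Y : C} (e : X ≅ Y) [IsConnected X] : IsConnected Y := by
  constructor
  · intro hY
    exact IsConnected.notInitial (X := X) (hY.ofIso e.symm)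
  · intro Z i _ hZ
    have h1 : IsIso (i ≫ e.inv) := IsConnected.noTrivialComponent Z (i ≫ e.inv) hZ
    have h2 : IsIso ((i ≫ e.inv) ≫ e.hom) := IsIso.comp_isIso
    simpa using h2

variable [GaloisCategory C]

/-- The fibre of the terminal object is a point. [cite: SGA1, Exp. V §4 (condition (G4))] -/
theorem nonempty_equiv_fiber_terminal_punit (F : C ⥤ FintypeCat.{w}) [FiberFunctor F] :
    Nonempty (F.obj (⊤_ C) ≃ PUnit.{w + 1}) :=
  ⟨(PreservesTerminal.iso (F ⋙ FintypeCat.incl) ≪≫ Types.terminalIso).toEquiv⟩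

/-- **The terminal object of a Galois category is connected** (its fibre is a single point, so it is
not initial and every non-initial subobject exhausts the fibre). [cite: SGA1, Exp. V §5] -/
theorem isConnected_terminal : IsConnected (⊤_ C) := by
  let F := GaloisCategory.getFiberFunctor C
  obtain ⟨e⟩ := nonempty_equiv_fiber_terminal_punit F
  constructor
  · intro h
    exact ((initial_iff_fiber_empty F (⊤_ C)).mp ⟨h⟩).false (e.symm PUnit.unit)
  · intro Z i _ hZ
    obtain ⟨z⟩ := (not_initial_iff_fiber_nonempty F Z).mp hZ
    apply isIso_of_mono_of_eq_card_fiber F i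
    have h1 : Nat.card (F.obj (⊤_ C)) = 1 := by
      rw [Nat.card_congr e, Nat.card_unique]
    have h2 : Nat.card (F.obj Z) ≤ 1 :=
      h1 ▸ Nat.card_le_card_of_injective (F.map i)
        (ConcreteCategory.injective_of_mono_of_preservesPullback (F.map i))
    have h3 : 1 ≤ Nat.card (F.obj Z) := Nat.one_le_iff_ne_zero.mpr (Nat.card_ne_zero.mpr ⟨⟨z⟩, inferInstance⟩)
    omega

section Sheets

variable (J : Type w) [Finite J]

/-- Each summand `1 ↪ ∐_J 1` is a connected subobject. [cite: SGA1, Exp. V §5] -/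
theorem isConnected_subobjectMk_sigma_ι (j : J) :
    IsConnected ((Subobject.mk (Sigma.ι (fun _ : J => ⊤_ C) j) : C)) :=
  haveI : IsConnected (⊤_ C) := isConnected_terminal
  isConnected_of_iso (Subobject.underlyingIso (Sigma.ι (fun _ : J => ⊤_ C) j)).symm

/-- In a Galois category the two injections `1 ⟶ 1 ⨿ 1` are different (the fibre of `1 ⨿ 1` has
two points, each the image of the point of the fibre of one summand). [cite: SGA1, Exp. V §5] -/
theorem coprod_inl_ne_inr_terminal : (coprod.inl : ⊤_ C ⟶ (⊤_ C) ⨿ (⊤_ C)) ≠ coprod.inr := by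
  let F := GaloisCategory.getFiberFunctor C
  obtain ⟨e⟩ := nonempty_equiv_fiber_terminal_punit F
  intro h
  -- every point of the fibre of `1 ⨿ 1` comes from one of the two summands
  have hsurj : ∀ x : F.obj ((⊤_ C) ⨿ (⊤_ C)), x = F.map coprod.inl (e.symm PUnit.unit) := by
    intro x
    obtain ⟨⟨j⟩, y, hy⟩ := Concrete.isColimit_exists_rep _
      (isColimitOfPreserves F (colimit.isColimit (pair (⊤_ C) (⊤_ C)))) x
    rcases j with _ | _
    · obtain ⟨y', rfl⟩ : ∃ y' : F.obj (⊤_ C), y' = y := ⟨y, rfl⟩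
      have hy1 : y' = e.symm PUnit.unit := e.injective (Subsingleton.elim _ _)
      rw [← hy, hy1]
      rfl
    · obtain ⟨y', rfl⟩ : ∃ y' : F.obj (⊤_ C), y' = y := ⟨y, rfl⟩
      have hy1 : y' = e.symm PUnit.unit := e.injective (Subsingleton.elim _ _)
      rw [← hy, hy1]
      exact congrArg (fun φ => F.map φ (e.symm PUnit.unit)) h.symm
  have hcard : Nat.card (F.obj ((⊤_ C) ⨿ (⊤_ C))) = 2 := by
    rw [card_fiber_coprod_eq_sum, Nat.card_congr e, Nat.card_unique]
  have hsub : Subsingleton (F.obj ((⊤_ C) ⨿ (⊤_ C))) :=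
    ⟨fun a b => by rw [hsurj a, hsurj b]⟩
  have h1 : Nat.card (F.obj ((⊤_ C) ⨿ (⊤_ C))) ≤ 1 := Finite.card_le_one_iff_subsingleton.mpr hsub
  omega

open Classical in
/-- **The summands of `∐_J 1` are pairwise distinct subobjects.** [cite: SGA1, Exp. V §5] -/
theorem subobjectMk_sigma_ι_injective :
    Function.Injective (fun j : J => Subobject.mk (Sigma.ι (fun _ : J => ⊤_ C) j)) := by
  intro j j' hjj'
  by_contra hne
  -- the characteristic map of the summand `j`
  let χ : (∐ fun _ : J => ⊤_ C) ⟶ (⊤_ C) ⨿ (⊤_ C) :=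
    Sigma.desc fun k => if k = j then coprod.inl else coprod.inr
  have hχj : Sigma.ι (fun _ : J => ⊤_ C) j ≫ χ = coprod.inl := by
    simp only [χ, Sigma.ι_desc, ite_true]
  have hχj' : Sigma.ι (fun _ : J => ⊤_ C) j' ≫ χ = coprod.inr := by
    simp only [χ, Sigma.ι_desc, if_neg (fun h : j' = j => hne h.symm)]
  -- an isomorphism of summands over `∐ 1`
  let e := Subobject.isoOfMkEqMk _ _ hjj'
  have he : e.hom ≫ Sigma.ι (fun _ : J => ⊤_ C) j' = Sigma.ι (fun _ : J => ⊤_ C) j :=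
    Subobject.ofMkLEMk_comp hjj'.le
  have he1 : e.hom = 𝟙 _ := terminal.hom_ext _ _
  rw [he1, Category.id_comp] at he
  apply coprod_inl_ne_inr_terminal (C := C)
  rw [← hχj, ← he, hχj']

/-- **Every connected subobject of `∐_J 1` is one of the summands.** [cite: SGA1, Exp. V §5] -/
theorem exists_eq_subobjectMk_sigma_ι (P : Subobject (∐ fun _ : J => ⊤_ C))
    (hP : IsConnected (P : C)) :
    ∃ j : J, P = Subobject.mk (Sigma.ι (fun _ : J => ⊤_ C) j) := by
  let F := GaloisCategory.getFiberFunctor C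
  haveI : IsConnected (⊤_ C) := isConnected_terminal
  obtain ⟨a⟩ := nonempty_fiber_of_isConnected F (P : C)
  -- the point `F(P.arrow) a` of the fibre of `∐ 1` comes from some summand
  obtain ⟨⟨j⟩, y, hy⟩ := Concrete.isColimit_exists_rep _
    (isColimitOfPreserves F (colimit.isColimit (Discrete.functor fun _ : J => ⊤_ C)))
    (F.map P.arrow a)
  refine ⟨j, ?_⟩
  -- `P` and the `j`-th summand share a point of the fibre, hence are isomorphic over `∐ 1`
  obtain ⟨y, rfl⟩ : ∃ y' : F.obj (⊤_ C), y' = y := ⟨y, rfl⟩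
  haveI : Mono (Sigma.ι (fun _ : J => ⊤_ C) j) :=
    MonoCoprod.mono_inj (fun _ : J => ⊤_ C) (colimit.cocone (Discrete.functor fun _ : J => ⊤_ C))
      (colimit.isColimit _) j
  have hy' : F.map P.arrow a = F.map (Sigma.ι (fun _ : J => ⊤_ C) j) y := hy.symm
  obtain ⟨f, hf⟩ := connected_component_unique F a y P.arrow (Sigma.ι (fun _ : J => ⊤_ C) j) hy'
  have hcomm : f.hom ≫ Sigma.ι (fun _ : J => ⊤_ C) j = P.arrow := by
    apply F.map_injective
    -- both sides agree on the unique point `a` of `F(P)`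
    obtain ⟨e⟩ := nonempty_equiv_fiber_terminal_punit F
    have hsub : Subsingleton (F.obj (P : C)) :=
      ((FintypeCat.incl.mapIso (F.mapIso f)).toEquiv.trans e).subsingleton
    ext x
    rw [Subsingleton.elim x a, F.map_comp]
    change F.map (Sigma.ι (fun _ : J => ⊤_ C) j) (F.map f.hom a) = F.map P.arrow a
    rw [hf, hy']
  calc P = Subobject.mk P.arrow := (Subobject.mk_arrow P).symm
    _ = Subobject.mk (Sigma.ι (fun _ : J => ⊤_ C) j) := Subobject.mk_eq_mk_of_comm _ _ f hcomm

end Sheets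

end Literature.AnabelianGeometry.Anabelioids
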